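import Summits.AtomisticToContinuum.HydrodynamicLimit.Theorems.CollisionIsometryCLTDiffuseBackwardInfluenceFewIdleSuperExp
import Summits.AtomisticToContinuum.HydrodynamicLimit.Theorems.SuperextensiveClosureCostTransferInequalityTools
import HarnessLib

/-!
# `stub_tubeLD` (crux `DiffuseBackwardInfluence`, stmt-AtomisticToContinuum-12950, line `share-nondegeneracy-one-flight`):
# the static tube large deviation reduced to a PRODUCT-MEASURE random-segment estimate

The registered stub `stub_tubeLD : ∀ σ θ, 0 < σ → σ < 1/2 → 0 < θ → FewIdle.TubeLD σ θ` is the static large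
deviation under the homogeneous hard-sphere Gibbs law `eqLaw σ θ` (`localGibbsLaw σ 1 0 θ`): for tube lengths `τ_N`
with `τ_N (N+1)^{1/3} → ∞`, every `η > 0` and every rate `c`, eventually in `N`, for every index set `A` with
`|A| ≥ η(N+1)` the straight tubes `r ↦ xᵢ + r vᵢ`, `r ∈ [0, τ_N]`, of the particles of `A` are pairwise at
minimal-image distance `≥ ε_N` only with probability `≤ e^{-c(N+1)}` (shared with line `ballistic-tubes`, and on the
NECESSARY side of the crux by `fewIdle_of_diffuseBackwardInfluence`, Disproof F3).

This file strips the Gibbs / hard-core layer off that statement (lead prover, continuation c1):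

* `FewIdle.stickLaw θ N` — the PRODUCT reference law on phase space: Lebesgue measure with density the plain tensor
  power `∏ᵢ M_{1,0,θ}(vᵢ)` of the one-particle profile (positions i.i.d. uniform on `𝕋³`, velocities i.i.d.
  Maxwellian at temperature `θ`; NO non-overlap conditioning, no partition function).
* `FewIdle.localGibbsMeasure_const_le_smul_stickLaw` — **free-volume domination**: for `0 < σ < 1/2`,
  `eqLaw σ θ ≤ (1 − 4πσ³/3)^{-(N+1)} • stickLaw θ N` as measures (the canonical density is
  `Z⁻¹ 𝟙_D ∏ f₀ ≤ Z⁻¹ ∏ f₀` pointwise, and `Z = Z_pos(1) ≥ (1 − 4πσ³/3)^{N+1}` by sequential insertion,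
  `TransferBudget.pow_le_posPartition`). The loss is only EXPONENTIAL in `N`.
* `FewIdle.StickLD σ θ` (`@[conjecture]`, obligation node) — the same tube event under `stickLaw`: an estimate about
  `N + 1` INDEPENDENT uniform × Maxwellian random segments of `𝕋³` (thickness `ε_N = σ(N+1)^{-1/3}`, duration `τ_N`),
  with no hard-sphere dynamics and no Gibbs conditioning left in it.
* `tubeLD_of_stickLD` (REGISTERED sub-goal) — `StickLD σ θ → TubeLD σ θ` for `0 < σ < 1/2`: at rate `c` use
  `StickLD` at rate `c + L`, `L := −log(1 − 4πσ³/3) ≥ 0`, and `e^{L(N+1)} e^{-(c+L)(N+1)} = e^{-c(N+1)}`.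

Heuristics for `StickLD` (not used): the cheapest non-crossing strategy is velocity coherence at resolution
`≍ 1/(ησ² τ_N (N+1)^{1/3})`, costing `3 log(τ_N (N+1)^{1/3}) + O(1)` nats per particle of `A` — super-linear in `N`
with a logarithmic margin; position clustering costs `O(1)` per particle and does not help (it raises the local
density); sheets / lanes / expanding patterns pay `≥ c log(τ_N (N+1)^{1/3})` per particle because a partner at
distance `r` is dodged only at velocity resolution `r/τ_N` and every shell `r ∈ [1/(ησ²(N+1)^{1/3}), τ_N √θ]`
carries `≥ 1` expected crossing.
-/

namespace Summit.AtomisticToContinuum.HydrodynamicLimit.Theorems.DiffuseBackwardInfluenceShare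

open scoped BigOperators Topology ENNReal Classical
open Filter Set MeasureTheory
open Literature.Analysis.FluidPDE
open Literature.MathematicalPhysics.KineticTheory (localGibbsLaw hsDiameter localGibbsProfile localGibbsMeasure
  localGibbsLaw_eq canonicalPartition_eq_posPartition posPartition localGibbsProfile_nonneg)
open Summit.AtomisticToContinuum.HydrodynamicLimit.Theorems.DiffuseBackwardInfluenceNeg

noncomputable section

namespace FewIdle

/-- **The product reference law** of `N + 1` particles at temperature `θ`: Lebesgue measure on phase space with
density the tensor power `∏ᵢ M_{1,0,θ}(vᵢ)` — positions i.i.d. uniform on `𝕋³`, velocities i.i.d. Maxwellian,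
no hard-core conditioning and no normalisation (it is a probability measure for `θ > 0`, not needed here). -/
def stickLaw (θ : ℝ) (N : ℕ) : Measure (Cfg N) :=
  volume.withDensity fun z => ENNReal.ofReal (tensorPow (N + 1) ((localGibbsProfile (fun _ => (1 : ℝ)) (fun _ => (0 : V3)) (fun _ => θ))) z)

/-- **THE PRODUCT-MEASURE TUBE LARGE DEVIATION** (obligation node; no proof in the tree or in print): the event
of `TubeLD` — the straight tubes `r ↦ xᵢ + r vᵢ`, `r ∈ [0, τ_N]`, of the particles of a prescribed index set `A`
with `|A| ≥ η(N+1)` stay pairwise at minimal-image distance `≥ ε_N` — has `stickLaw θ N`-measure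
`≤ exp(−c(N+1))` for EVERY rate `c`, eventually in `N`, whenever `τ_N > 0` and `τ_N (N+1)^{1/3} → ∞`. Under
`stickLaw` the `N + 1` particles are INDEPENDENT uniform × Maxwellian random segments, so this is a statement
about i.i.d. random segments of `𝕋³` only. -/
@[conjecture] def StickLD (σ θ : ℝ) : Prop :=
  ∀ τ : ℕ → ℝ, (∀ N, 0 < τ N) → Tendsto (fun N : ℕ => τ N * ((N + 1 : ℕ) : ℝ) ^ ((1 : ℝ) / 3)) atTop atTop →
    ∀ η : ℝ, 0 < η → ∀ c : ℝ, ∀ᶠ N : ℕ in atTop, ∀ A : Finset (Fin (N + 1)),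
      η * ((N + 1 : ℕ) : ℝ) ≤ (A.card : ℝ) →
        stickLaw θ N (tubeSet σ N A (τ N)) ≤ ENNReal.ofReal (Real.exp (-(c * ((N + 1 : ℕ) : ℝ))))

/-- The free-volume constant `q_σ := 1 − 4πσ³/3` lies in `(0, 1]` for `0 ≤ σ < 1/2`. [folklore] -/
theorem freeVolume_pos {σ : ℝ} (hσ0 : 0 ≤ σ) (hσ : σ < 1 / 2) :
    0 < 1 - 4 * Real.pi / 3 * σ ^ 3 ∧ 1 - 4 * Real.pi / 3 * σ ^ 3 ≤ 1 := by
  have hpi := Real.pi_lt_four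
  have hσ3 : σ ^ 3 < 1 / 8 := by
    have := pow_lt_pow_left₀ hσ hσ0 three_ne_zero
    norm_num at this
    exact this
  have h3 : 0 ≤ σ ^ 3 := pow_nonneg hσ0 3
  constructor
  · nlinarith [Real.pi_pos]
  · nlinarith [Real.pi_pos]

/-- **Free-volume domination of the homogeneous Gibbs law by the product law**: for `0 < σ < 1/2` and `0 < θ`,
`localGibbsMeasure σ 1 0 θ N ≤ ((1 − 4πσ³/3)^{N+1})⁻¹ • stickLaw θ N` — the canonical density is
`Z⁻¹ 𝟙_D ∏ᵢ f₀ ≤ Z⁻¹ ∏ᵢ f₀` pointwise and `Z = Z_pos(1) ≥ (1 − 4πσ³/3)^{N+1}`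
(`TransferBudget.pow_le_posPartition`). [folklore] -/
theorem localGibbsMeasure_const_le_smul_stickLaw {σ θ : ℝ} (hσ : 0 < σ) (hσ2 : σ < 1 / 2) (hθ : 0 < θ)
    (N : ℕ) :
    localGibbsMeasure σ (fun _ => (1 : ℝ)) (fun _ => (0 : V3)) (fun _ => θ) N ≤
      ENNReal.ofReal (((1 - 4 * Real.pi / 3 * σ ^ 3) ^ (N + 1))⁻¹) • stickLaw θ N := by
  obtain ⟨hq0, _⟩ := freeVolume_pos hσ.le hσ2
  set q : ℝ := 1 - 4 * Real.pi / 3 * σ ^ 3 with hq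
  set ε : ℝ := hsDiameter σ N with hε
  set Z : ℝ := canonicalPartition (Torus.geometry (Fin 3)) ε (N + 1) ((localGibbsProfile (fun _ => (1 : ℝ)) (fun _ => (0 : V3)) (fun _ => θ))) with hZ
  -- the partition function is the configurational one, bounded below by the free volume
  have hZpos : Z = posPartition (fun _ => (1 : ℝ)) ε (N + 1) :=
    canonicalPartition_eq_posPartition (a₀ := fun _ => (1 : ℝ)) (u₀ := fun _ => (0 : V3)) (θ₀ := fun _ => θ)
      continuous_const continuous_const continuous_const (fun _ => zero_le_one) (fun _ => hθ) ε (N + 1)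
  have hZge : q ^ (N + 1) ≤ Z := by
    rw [hZpos, hε]
    have h := TransferBudget.pow_le_posPartition (a₀ := fun _ => (1 : ℝ)) continuous_const zero_le_one
      (fun _ => le_rfl) hσ hσ2 N
    rwa [one_mul] at h
  have hqN : 0 < q ^ (N + 1) := pow_pos hq0 _
  have hZ0 : 0 < Z := hqN.trans_le hZge
  have hZinv : Z⁻¹ ≤ (q ^ (N + 1))⁻¹ := (inv_le_inv₀ hZ0 hqN).2 hZge
  have hf0 : 0 ≤ localGibbsProfile (fun _ => (1 : ℝ)) (fun _ => (0 : V3)) (fun _ => θ) := fun y =>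
    localGibbsProfile_nonneg (fun _ => zero_le_one) (fun _ => hθ.le) y
  -- pointwise comparison of the densities
  have hpt : ∀ z : Cfg N,
      ENNReal.ofReal (canonicalDensity (Torus.geometry (Fin 3)) ε (N + 1) ((localGibbsProfile (fun _ => (1 : ℝ)) (fun _ => (0 : V3)) (fun _ => θ))) z) ≤
        ENNReal.ofReal ((q ^ (N + 1))⁻¹) * ENNReal.ofReal (tensorPow (N + 1) ((localGibbsProfile (fun _ => (1 : ℝ)) (fun _ => (0 : V3)) (fun _ => θ))) z) := by
    intro z
    have hT : 0 ≤ tensorPow (N + 1) ((localGibbsProfile (fun _ => (1 : ℝ)) (fun _ => (0 : V3)) (fun _ => θ))) z := tensorPow_nonneg hf0 _ z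
    rw [← ENNReal.ofReal_mul (inv_nonneg.2 hqN.le)]
    refine ENNReal.ofReal_le_ofReal ?_
    unfold canonicalDensity
    rw [← hZ]
    have hind : (hardSphereDomain (Torus.geometry (Fin 3)) (N + 1) ε).indicator
        (tensorPow (N + 1) ((localGibbsProfile (fun _ => (1 : ℝ)) (fun _ => (0 : V3)) (fun _ => θ)))) z ≤ tensorPow (N + 1) ((localGibbsProfile (fun _ => (1 : ℝ)) (fun _ => (0 : V3)) (fun _ => θ))) z :=
      Set.indicator_le_self' (fun _ _ => hT) z
    have hind0 : 0 ≤ (hardSphereDomain (Torus.geometry (Fin 3)) (N + 1) ε).indicator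
        (tensorPow (N + 1) ((localGibbsProfile (fun _ => (1 : ℝ)) (fun _ => (0 : V3)) (fun _ => θ)))) z :=
      Set.indicator_nonneg (fun _ _ => hT) z
    calc Z⁻¹ * (hardSphereDomain (Torus.geometry (Fin 3)) (N + 1) ε).indicator
          (tensorPow (N + 1) ((localGibbsProfile (fun _ => (1 : ℝ)) (fun _ => (0 : V3)) (fun _ => θ)))) z
        ≤ (q ^ (N + 1))⁻¹ * (hardSphereDomain (Torus.geometry (Fin 3)) (N + 1) ε).indicator
            (tensorPow (N + 1) ((localGibbsProfile (fun _ => (1 : ℝ)) (fun _ => (0 : V3)) (fun _ => θ)))) z := mul_le_mul_of_nonneg_right hZinv hind0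
      _ ≤ (q ^ (N + 1))⁻¹ * tensorPow (N + 1) ((localGibbsProfile (fun _ => (1 : ℝ)) (fun _ => (0 : V3)) (fun _ => θ))) z :=
            mul_le_mul_of_nonneg_left hind (inv_nonneg.2 hqN.le)
  calc localGibbsMeasure σ (fun _ => (1 : ℝ)) (fun _ => (0 : V3)) (fun _ => θ) N
      = volume.withDensity (fun z => ENNReal.ofReal
          (canonicalDensity (Torus.geometry (Fin 3)) ε (N + 1) ((localGibbsProfile (fun _ => (1 : ℝ)) (fun _ => (0 : V3)) (fun _ => θ))) z)) := rfl
    _ ≤ volume.withDensity (fun z => ENNReal.ofReal ((q ^ (N + 1))⁻¹) *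
          ENNReal.ofReal (tensorPow (N + 1) ((localGibbsProfile (fun _ => (1 : ℝ)) (fun _ => (0 : V3)) (fun _ => θ))) z)) :=
        withDensity_mono (Eventually.of_forall hpt)
    _ = ENNReal.ofReal ((q ^ (N + 1))⁻¹) • stickLaw θ N := by
        rw [stickLaw, ← withDensity_smul' _ _ ENNReal.ofReal_ne_top]
        rfl

/-- The same domination for `eqLaw σ θ N Φ` (which is `localGibbsMeasure σ 1 0 θ N` for every flow `Φ`). [folklore] -/
theorem eqLaw_le_smul_stickLaw {σ θ : ℝ} (hσ : 0 < σ) (hσ2 : σ < 1 / 2) (hθ : 0 < θ) (N : ℕ) (Φ : Flow σ N) :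
    eqLaw σ θ N Φ ≤ ENNReal.ofReal (((1 - 4 * Real.pi / 3 * σ ^ 3) ^ (N + 1))⁻¹) • stickLaw θ N := by
  have h : eqLaw σ θ N Φ = localGibbsMeasure σ (fun _ => (1 : ℝ)) (fun _ => (0 : V3)) (fun _ => θ) N := by
    unfold eqLaw
    exact localGibbsLaw_eq σ _ _ _ N Φ
  rw [h]
  exact localGibbsMeasure_const_le_smul_stickLaw hσ hσ2 hθ N

/-- Rate bookkeeping: `(q^{N+1})⁻¹ · e^{-(c + L)(N+1)} ≤ e^{-c(N+1)}` for `L = -log q`, `0 < q ≤ 1`. [folklore] -/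
theorem inv_pow_mul_exp_le {q : ℝ} (hq0 : 0 < q) (c : ℝ) (N : ℕ) :
    (q ^ (N + 1))⁻¹ * Real.exp (-((c + -Real.log q) * ((N + 1 : ℕ) : ℝ))) ≤
      Real.exp (-(c * ((N + 1 : ℕ) : ℝ))) := by
  have hqN : 0 < q ^ (N + 1) := pow_pos hq0 _
  have hinv : (q ^ (N + 1))⁻¹ = Real.exp (-Real.log q * ((N + 1 : ℕ) : ℝ)) := by
    rw [← Real.exp_log hqN, ← Real.exp_neg, Real.log_pow]
    congr 1
    push_cast
    ring
  rw [hinv, ← Real.exp_add]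
  refine le_of_eq ?_
  congr 1
  ring

end FewIdle

/-- **REGISTERED SUB-GOAL — `stub_tubeLD` from the product-measure random-segment estimate:** for `0 < σ < 1/2`
and `0 < θ`, `FewIdle.StickLD σ θ → FewIdle.TubeLD σ θ` (free-volume domination
`eqLaw ≤ (1 − 4πσ³/3)^{-(N+1)} • stickLaw`, and the exponential loss is absorbed by the arbitrary rate: use
`StickLD` at rate `c − log(1 − 4πσ³/3)`). [folklore] -/
theorem tubeLD_of_stickLD : ∀ σ θ : ℝ, 0 < σ → σ < 1 / 2 → 0 < θ → FewIdle.StickLD σ θ → FewIdle.TubeLD σ θ := by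
  intro σ θ hσ hσ2 hθ hS τ hτ hτg η hη c
  obtain ⟨hq0, hq1⟩ := FewIdle.freeVolume_pos hσ.le hσ2
  set q : ℝ := 1 - 4 * Real.pi / 3 * σ ^ 3 with hq
  filter_upwards [hS τ hτ hτg η hη (c + -Real.log q)] with N hN Φ A hA
  have hdom := FewIdle.eqLaw_le_smul_stickLaw hσ hσ2 hθ N Φ
  have hqN : 0 < q ^ (N + 1) := pow_pos hq0 _
  calc eqLaw σ θ N Φ {z : Cfg N | ∀ i ∈ A, ∀ j ∈ A, i ≠ j → ∀ r ∈ Set.Icc (0 : ℝ) (τ N),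
          hsDiameter σ N ≤ ‖(Torus.geometry (Fin 3)).sepVec (freeFlight (Torus.geometry (Fin 3)) r z i).1
            (freeFlight (Torus.geometry (Fin 3)) r z j).1‖}
      = eqLaw σ θ N Φ (FewIdle.tubeSet σ N A (τ N)) := rfl
    _ ≤ (ENNReal.ofReal ((q ^ (N + 1))⁻¹) • FewIdle.stickLaw θ N) (FewIdle.tubeSet σ N A (τ N)) :=
        hdom _
    _ = ENNReal.ofReal ((q ^ (N + 1))⁻¹) * FewIdle.stickLaw θ N (FewIdle.tubeSet σ N A (τ N)) := by
        rw [Measure.smul_apply, smul_eq_mul]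
    _ ≤ ENNReal.ofReal ((q ^ (N + 1))⁻¹) *
          ENNReal.ofReal (Real.exp (-((c + -Real.log q) * ((N + 1 : ℕ) : ℝ)))) := by
        gcongr
        exact hN A hA
    _ = ENNReal.ofReal ((q ^ (N + 1))⁻¹ * Real.exp (-((c + -Real.log q) * ((N + 1 : ℕ) : ℝ)))) :=
        (ENNReal.ofReal_mul (inv_nonneg.2 hqN.le)).symm
    _ ≤ ENNReal.ofReal (Real.exp (-(c * ((N + 1 : ℕ) : ℝ)))) :=
        ENNReal.ofReal_le_ofReal (FewIdle.inv_pow_mul_exp_le hq0 c N)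

end

end Summit.AtomisticToContinuum.HydrodynamicLimit.Theorems.DiffuseBackwardInfluenceShare
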